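import Summits.HodgeConjecture.HodgeConjecture.Theorems.F0P3cStCharTSShellOrbitalGPsi   -- ★ p849763 (this seat): the Ψ-producer and its torus bookkeeping (`glDiagonal_torusEntry_eq`, `valued_apply_ne_zero_of_isUnit`, …)
import Summits.HodgeConjecture.HodgeConjecture.Theorems.F0P3cStCharTSShellRoots        -- ★ D3-i (LH6-p04): `valuation_extremes_of_charpoly_diagonal_eq_shell`
import Literature.NumberTheory.Automorphic.HeisenbergChartAtNonsplitPlace            -- ★ `valued_conjLocal_apply_of_smul_eq`
import Literature.NumberTheory.Automorphic.UnitaryGroupHeisenbergRing                -- ★ `HeisRing.torus_relations`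
import Literature.NumberTheory.Automorphic.UnitaryGroupNonsplitPlace                 -- ★ `PlacesOver.subsingleton_of_smul_eq`
import Literature.NumberTheory.Automorphic.CMBorelIwahoriShellBound                  -- ★ `isClosed_cmBorelTriple_M`
import HarnessLib

/-!
# F0 · P3c · line LH6 «StCharTS» — road (D), brick D3-ii «S-SHELL»: the compact set `S ⊆ M` carrying the canonical orbital integrals of the shell indicator
# `𝟙_{K b K}` — the data `S hSc hSreg hSunit hSoff` of the Ψ-producer ★ `exists_normalizedOrbitalIntegral_isLocallyConstant_hasCompactSupport` (p849763)

Cell `pub/hodgecm-mathlib`, crux H413 = `stmt-HodgeConjecture-24833` (lane `--supports … --as helper`); seat LH2-p03 (g3); road (D) owner LH6-p03 (g0) ∕ LH6-p04 (g3),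
dealer F0P3b-plan (g23).  THEOREMS ONLY, sorry-free, ★-only imports.  HONEST LABEL: HC_CM is proved only modulo the 7 printed citations (2 remaining: hLiu418 =
stmt-HodgeConjecture-24832, h413 = stmt-HodgeConjecture-24833) until rung 0 closes; count-neutral.

THE MATHEMATICS ([Rogawski1990, §12.7 L. 12.7.3 (proof) p. 195; §4.9 p. 55]; [Casselman1995, §1.5]).  Place `w ∣ v` non-split (`σ • w = w`; then
`∏_{w′∣v} L_{w′} = L_w`, ★ `PlacesOver.subsingleton_of_smul_eq`).  `b = diag(d) ∈ M` with `|d₀|_w < |d₁|_w < |d₂|_w` (a dominant shell element; by the torus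
relations ★ `torus_relations` and `|σx|_w = |x|_w`: `|d₁| = 1`, `|d₀||d₂| = 1`), `K ≤ U(Φ₃)(L⁺_v)` with `|k_ij − δ_ij|_w ≤ r < 1` on `K`.  Put
`S := {t ∈ M ∣ b⁻¹t ∈ K_v or bt ∈ K_v}` (`K_v` = ★ `cmLocalIntegralLevel`; `t ∈ M ∩ K_v` iff all `|t_ii|_w = 1`, §1), i.e. the torus elements with the
valuation pattern of `b` or of `bʷ`.  (S1) `S` is compact (`M` closed ★, `K_v` compact ★, translates).  (S2) `t ∈ S` has pairwise distinct `|t_ii|_w`, so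
`t_ii − t_jj` (`i ≠ j`) are units: `d₀⁻¹d_j − 1` are units and `charpoly t = ∏ (X − t_ii)` is separable (`e t` is regular, ★ `isRegularElt_conj_iff`).  (S3) if
`g = k₁ b k₂ ∈ K b K` has `charpoly g = charpoly t` then, at `w`, ★ D3-i `valuation_extremes_of_charpoly_diagonal_eq_shell` pins `{|t_ii|}` between `|d₀|` and
`|d₂|` with both extremes attained; with `|t₁₁| = 1`, `|t₀₀||t₂₂| = 1` this leaves the patterns of `b` and `bʷ`, i.e. `t ∈ S`.  Hence for `t ∉ S` no conjugate
of `t` (or of `e t`, any frame `e`) lies in `tsupport 𝟙_{KbK} ⊆ K b K` (closed: `K` compact).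

## References
* [Rogawski1990] J. D. Rogawski, *Automorphic Representations of Unitary Groups in Three Variables*, Ann. of Math. Stud. 123 (1990), §12.7 L. 12.7.3 (proof) p. 195; §4.9 p. 55;
  §1.10 p. 9; §12.1 p. 171.
* [Casselman1995] W. Casselman, *Introduction to the theory of admissible representations of p-adic reductive groups* (1995 notes), §1.5.
-/

set_option autoImplicit false
set_option linter.dupNamespace false

noncomputable section

open NumberField IsDedekindDomain MeasureTheory Topology Filter Set Polynomial
open scoped Matrix MatrixGroups NNReal
open Literature.MeasureTheory.Group Literature.NumberTheory.Automorphic Literature.NumberTheory.Automorphic.UnitaryGroup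
open Literature.NumberTheory.Rogawski1990

namespace Summit.HodgeConjecture.HodgeConjecture.Cruxes.H413.F0P3cStCharTSShellOrbitalG

variable (L : Type) [Field L] [NumberField L] [IsCMField L]

/-! ## §1 Units, valuations at the non-split place, and the torus `M ∩ K_v` -/

/-- `x² = 1 ⇒ x = 1` in the (linearly ordered) value group `ℤₘ₀`. [folklore] -/
private theorem sq_eq_one_aux {x : WithZero (Multiplicative ℤ)} (h : x * x = 1) : x = 1 := by
  rcases lt_trichotomy x 1 with hx | hx | hx
  · exact absurd h (ne_of_lt (mul_lt_one' hx hx))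
  · exact hx
  · exact absurd h (ne_of_gt (one_lt_mul'' hx hx))

/-- **At a non-split place a vector of `∏_{w′∣v} L_{w′} = L_w` is a unit iff its `w`-valuation is non-zero.** [cite: Rogawski1990, §1.9 p. 8] -/
theorem isUnit_iff_valued_apply_ne_zero {v : HeightOneSpectrum (𝓞 ↥(maximalRealSubfield L))} (w : PlacesOver L v) (hw : IsCMField.complexConj L • w.1 = w.1) (x : LocalRing L v) :
    IsUnit x ↔ Valued.v (x w) ≠ 0 := by
  haveI : Algebra.IsQuadraticExtension ↥(maximalRealSubfield L) L := IsCMField.isQuadraticExtension L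
  haveI : Subsingleton (PlacesOver L v) :=
    PlacesOver.subsingleton_of_smul_eq (IsCMField.complexConj L) (IsCMField.complexConj_ne_one L) w hw
  refine ⟨fun hx => valued_apply_ne_zero_of_isUnit L v hx w, fun hx => ?_⟩
  have hne : ∀ w' : PlacesOver L v, x w' ≠ 0 := fun w' => by
    rw [Subsingleton.elim w' w]; exact (Valuation.ne_zero_iff _).1 hx
  exact isUnit_iff_exists_inv.2 ⟨fun w' => (x w')⁻¹, funext fun w' => mul_inv_cancel₀ (hne w')⟩

/-- **Torus valuations**: for `t = diag(d) ∈ M ≤ U(Φ₃)(L⁺_v)` and `w` non-split, `|d₀|_w · |d₂|_w = 1` and `|d₁|_w = 1` (★ `torus_relations`: `σ(d₂)d₀ = 1`,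
`σ(d₁)d₁ = 1`; ★ `valued_conjLocal_apply_of_smul_eq`: `|σx|_w = |x|_w`). [cite: Rogawski1990, §1.10 p. 9; §12.1 p. 171] -/
theorem valued_torus_diag_rel {v : HeightOneSpectrum (𝓞 ↥(maximalRealSubfield L))} (w : PlacesOver L v) (hw : IsCMField.complexConj L • w.1 = w.1) (t : ↥(cmBorelTriple L 3 v).M) {d : Fin 3 → (LocalRing L v)ˣ}
    (hd : glDiagonal 3 (LocalRing L v) d = ((t : ↥(unitaryGroupOfForm (conjLocal L (IsCMField.complexConj L) v) (cmLocalForm L 3 v))) : GL (Fin 3) (LocalRing L v))) :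
    Valued.v ((((d 0 : (LocalRing L v)ˣ) : LocalRing L v) : LocalRing L v) w) * Valued.v ((((d 2 : (LocalRing L v)ˣ) : LocalRing L v) : LocalRing L v) w) = 1 ∧ Valued.v ((((d 1 : (LocalRing L v)ˣ) : LocalRing L v) : LocalRing L v) w) = 1 := by
  obtain ⟨h20, h11, -⟩ := HeisRing.torus_relations (conjLocal L (IsCMField.complexConj L) v) (cmLocalForm_eq_over L 3 v) t hd
  have e20 := congrArg (fun x : LocalRing L v => Valued.v (x w)) h20
  have e11 := congrArg (fun x : LocalRing L v => Valued.v (x w)) h11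
  simp only [Pi.mul_apply, map_mul, Pi.one_apply, map_one, valued_conjLocal_apply_of_smul_eq L v w hw] at e20 e11
  exact ⟨by rw [mul_comm]; exact e20, sq_eq_one_aux e11⟩

/-- **`t ∈ M` with all `|t_ii|_w = 1` lies in `K_v`** (★ `mem_cmLocalIntegralLevel_iff_forall_v_le_one`: the entries of `t = diag(t_ii)` and of `t⁻¹ = diag(t_ii⁻¹)`
are integral). [cite: Rogawski1990, §12.1 p. 171; §4.5 p. 45] -/
theorem coe_mem_cmLocalIntegralLevel_of_valued_torusEntry_eq_one {v : HeightOneSpectrum (𝓞 ↥(maximalRealSubfield L))} (w : PlacesOver L v) (hw : IsCMField.complexConj L • w.1 = w.1) (s : ↥(cmBorelTriple L 3 v).M)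
    (hs : ∀ i : Fin 3, Valued.v ((((torusEntry (conjLocal L (IsCMField.complexConj L) v) (cmLocalForm L 3 v) i s : (LocalRing L v)ˣ) : LocalRing L v) : LocalRing L v) w) = 1) :
    (s : ↥(unitaryGroupOfForm (conjLocal L (IsCMField.complexConj L) v) (cmLocalForm L 3 v))) ∈ cmLocalIntegralLevel L 3 (Matrix.of fun i j : Fin 3 => if i.val + j.val + 1 = 3 then (1 : L) else 0) v := by
  haveI : Algebra.IsQuadraticExtension ↥(maximalRealSubfield L) L := IsCMField.isQuadraticExtension L
  haveI : Subsingleton (PlacesOver L v) :=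
    PlacesOver.subsingleton_of_smul_eq (IsCMField.complexConj L) (IsCMField.complexConj_ne_one L) w hw
  have hmat : ∀ (r : ↥(cmBorelTriple L 3 v).M) (i j : Fin 3), (((r : ↥(unitaryGroupOfForm (conjLocal L (IsCMField.complexConj L) v) (cmLocalForm L 3 v))) : GL (Fin 3) (LocalRing L v)).val i j) =
      (Matrix.diagonal fun k => ((torusEntry (conjLocal L (IsCMField.complexConj L) v) (cmLocalForm L 3 v) k r : (LocalRing L v)ˣ) : LocalRing L v)) i j := fun r i j => by
    rw [← glDiagonal_torusEntry_eq L v r, coe_glDiagonal]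
  have hinv : ∀ i : Fin 3, Valued.v ((((torusEntry (conjLocal L (IsCMField.complexConj L) v) (cmLocalForm L 3 v) i s⁻¹ : (LocalRing L v)ˣ) : LocalRing L v) : LocalRing L v) w) = 1 := fun i => by
    rw [map_inv, Units.val_inv_eq_inv_val, Pi.inv_apply, map_inv₀, hs i, inv_one]
  refine (mem_cmLocalIntegralLevel_iff_forall_v_le_one L 3 v _).2 ⟨fun i j w' => ?_, fun i j w' => ?_⟩
  · rw [Subsingleton.elim w' w, hmat, Matrix.diagonal_apply]
    split_ifs with hij
    · exact (hs i).le
    · rw [Pi.zero_apply, map_zero]; exact zero_le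
  · rw [Subsingleton.elim w' w, ← Subgroup.coe_inv, hmat, Matrix.diagonal_apply]
    split_ifs with hij
    · exact (hinv i).le
    · rw [Pi.zero_apply, map_zero]; exact zero_le

/-! ## §2 The set `S` and its compactness -/

/-- **(S1) `S = {t ∈ M ∣ b⁻¹t ∈ K_v ∨ bt ∈ K_v}` IS COMPACT**: `M ∩ K_v` is compact (closed embedding `M ↪ U(Φ₃)`, ★ `isClosed_cmBorelTriple_M`; `K_v` compact ★
`isCompact_isOpen_cmLocalIntegralLevel`) and `S` is the union of two of its translates. [cite: Rogawski1990, §12.1 p. 171; §4.9 p. 55] -/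
theorem isCompact_shellTorusSet (v : HeightOneSpectrum (𝓞 ↥(maximalRealSubfield L)))
    {b : ↥(unitaryGroupOfForm (conjLocal L (IsCMField.complexConj L) v) (cmLocalForm L 3 v))} (hbM : b ∈ (cmBorelTriple L 3 v).M) :
    IsCompact {t : ↥(cmBorelTriple L 3 v).M | (((((⟨b, hbM⟩ : ↥(cmBorelTriple L 3 v).M))⁻¹ * t : ↥(cmBorelTriple L 3 v).M) : ↥(unitaryGroupOfForm (conjLocal L (IsCMField.complexConj L) v) (cmLocalForm L 3 v))) ∈ cmLocalIntegralLevel L 3 (Matrix.of fun i j : Fin 3 => if i.val + j.val + 1 = 3 then (1 : L) else 0) v) ∨ (((((⟨b, hbM⟩ : ↥(cmBorelTriple L 3 v).M)) * t : ↥(cmBorelTriple L 3 v).M) : ↥(unitaryGroupOfForm (conjLocal L (IsCMField.complexConj L) v) (cmLocalForm L 3 v))) ∈ cmLocalIntegralLevel L 3 (Matrix.of fun i j : Fin 3 => if i.val + j.val + 1 = 3 then (1 : L) else 0) v)} := by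
  obtain ⟨hKc, -⟩ := isCompact_isOpen_cmLocalIntegralLevel L 3 (Matrix.of fun i j : Fin 3 => if i.val + j.val + 1 = 3 then (1 : L) else 0) v
  have hC : IsCompact {t : ↥(cmBorelTriple L 3 v).M | (t : ↥(unitaryGroupOfForm (conjLocal L (IsCMField.complexConj L) v) (cmLocalForm L 3 v))) ∈ cmLocalIntegralLevel L 3 (Matrix.of fun i j : Fin 3 => if i.val + j.val + 1 = 3 then (1 : L) else 0) v} :=
    (isClosed_cmBorelTriple_M L v).isClosedEmbedding_subtypeVal.isCompact_preimage hKc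
  have h1 : IsCompact ((fun t : ↥(cmBorelTriple L 3 v).M => ((⟨b, hbM⟩ : ↥(cmBorelTriple L 3 v).M))⁻¹ * t) ⁻¹' {t : ↥(cmBorelTriple L 3 v).M | (t : ↥(unitaryGroupOfForm (conjLocal L (IsCMField.complexConj L) v) (cmLocalForm L 3 v))) ∈ cmLocalIntegralLevel L 3 (Matrix.of fun i j : Fin 3 => if i.val + j.val + 1 = 3 then (1 : L) else 0) v}) :=
    (Homeomorph.mulLeft ((⟨b, hbM⟩ : ↥(cmBorelTriple L 3 v).M))⁻¹).isCompact_preimage.2 hC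
  have h2 : IsCompact ((fun t : ↥(cmBorelTriple L 3 v).M => ((⟨b, hbM⟩ : ↥(cmBorelTriple L 3 v).M)) * t) ⁻¹' {t : ↥(cmBorelTriple L 3 v).M | (t : ↥(unitaryGroupOfForm (conjLocal L (IsCMField.complexConj L) v) (cmLocalForm L 3 v))) ∈ cmLocalIntegralLevel L 3 (Matrix.of fun i j : Fin 3 => if i.val + j.val + 1 = 3 then (1 : L) else 0) v}) :=
    (Homeomorph.mulLeft ((⟨b, hbM⟩ : ↥(cmBorelTriple L 3 v).M))).isCompact_preimage.2 hC
  convert h1.union h2 using 1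
  ext t
  simp only [Set.mem_setOf_eq, Set.mem_union, Set.mem_preimage]

/-! ## §3 The valuation pattern on `S`: regularity and the unit conditions -/

set_option maxHeartbeats 1600000 in
/-- **The valuation pattern of `t ∈ S`**: `(|t₀₀|, |t₁₁|, |t₂₂|)_w` is `(|d₀|, |d₁|, |d₂|)` or `(|d₂|, |d₁|, |d₀|)`. [cite: Rogawski1990, §4.9 p. 55; §12.7 p. 195] -/
theorem valued_torusEntry_of_mem_shellTorusSet {v : HeightOneSpectrum (𝓞 ↥(maximalRealSubfield L))} (w : PlacesOver L v) (hw : IsCMField.complexConj L • w.1 = w.1)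
    {b : ↥(unitaryGroupOfForm (conjLocal L (IsCMField.complexConj L) v) (cmLocalForm L 3 v))} (hbM : b ∈ (cmBorelTriple L 3 v).M) {d : Fin 3 → (LocalRing L v)ˣ} (hd : glDiagonal 3 (LocalRing L v) d = (b : GL (Fin 3) (LocalRing L v)))
    {t : ↥(cmBorelTriple L 3 v).M} (ht : t ∈ {t : ↥(cmBorelTriple L 3 v).M | (((((⟨b, hbM⟩ : ↥(cmBorelTriple L 3 v).M))⁻¹ * t : ↥(cmBorelTriple L 3 v).M) : ↥(unitaryGroupOfForm (conjLocal L (IsCMField.complexConj L) v) (cmLocalForm L 3 v))) ∈ cmLocalIntegralLevel L 3 (Matrix.of fun i j : Fin 3 => if i.val + j.val + 1 = 3 then (1 : L) else 0) v) ∨ (((((⟨b, hbM⟩ : ↥(cmBorelTriple L 3 v).M)) * t : ↥(cmBorelTriple L 3 v).M) : ↥(unitaryGroupOfForm (conjLocal L (IsCMField.complexConj L) v) (cmLocalForm L 3 v))) ∈ cmLocalIntegralLevel L 3 (Matrix.of fun i j : Fin 3 => if i.val + j.val + 1 = 3 then (1 : L) else 0) v)}) :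
    (∀ i : Fin 3, Valued.v ((((torusEntry (conjLocal L (IsCMField.complexConj L) v) (cmLocalForm L 3 v) i t : (LocalRing L v)ˣ) : LocalRing L v) : LocalRing L v) w) = Valued.v ((((d i : (LocalRing L v)ˣ) : LocalRing L v) : LocalRing L v) w)) ∨
      (Valued.v ((((torusEntry (conjLocal L (IsCMField.complexConj L) v) (cmLocalForm L 3 v) 0 t : (LocalRing L v)ˣ) : LocalRing L v) : LocalRing L v) w) = Valued.v ((((d 2 : (LocalRing L v)ˣ) : LocalRing L v) : LocalRing L v) w) ∧ Valued.v ((((torusEntry (conjLocal L (IsCMField.complexConj L) v) (cmLocalForm L 3 v) 1 t : (LocalRing L v)ˣ) : LocalRing L v) : LocalRing L v) w) = Valued.v ((((d 1 : (LocalRing L v)ˣ) : LocalRing L v) : LocalRing L v) w) ∧ Valued.v ((((torusEntry (conjLocal L (IsCMField.complexConj L) v) (cmLocalForm L 3 v) 2 t : (LocalRing L v)ˣ) : LocalRing L v) : LocalRing L v) w) = Valued.v ((((d 0 : (LocalRing L v)ˣ) : LocalRing L v) : LocalRing L v) w)) := by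
  have hdb : ∀ i : Fin 3, torusEntry (conjLocal L (IsCMField.complexConj L) v) (cmLocalForm L 3 v) i (⟨b, hbM⟩ : ↥(cmBorelTriple L 3 v).M) = d i := fun i => torusEntry_eq_of_glDiagonal_eq (conjLocal L (IsCMField.complexConj L) v) (cmLocalForm L 3 v) i _ d hd
  rcases ht with h | h
  · left
    intro i
    have h1 := v_torusEntry_eq_one_of_mem_cmLocalIntegralLevel L 3 v _ h i w
    rw [map_mul, map_inv, hdb, Units.val_mul, Units.val_inv_eq_inv_val, Pi.mul_apply, Pi.inv_apply, map_mul, map_inv₀] at h1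
    have hne : Valued.v ((((d i : (LocalRing L v)ˣ) : LocalRing L v) : LocalRing L v) w) ≠ 0 := valued_apply_ne_zero_of_isUnit L v (d i).isUnit w
    calc Valued.v ((((torusEntry (conjLocal L (IsCMField.complexConj L) v) (cmLocalForm L 3 v) i t : (LocalRing L v)ˣ) : LocalRing L v) : LocalRing L v) w) = Valued.v ((((d i : (LocalRing L v)ˣ) : LocalRing L v) : LocalRing L v) w) * ((Valued.v ((((d i : (LocalRing L v)ˣ) : LocalRing L v) : LocalRing L v) w))⁻¹ * Valued.v ((((torusEntry (conjLocal L (IsCMField.complexConj L) v) (cmLocalForm L 3 v) i t : (LocalRing L v)ˣ) : LocalRing L v) : LocalRing L v) w)) := by rw [← mul_assoc, mul_inv_cancel₀ hne, one_mul]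
      _ = Valued.v ((((d i : (LocalRing L v)ˣ) : LocalRing L v) : LocalRing L v) w) := by rw [h1, mul_one]
  · right
    have h1 : ∀ i : Fin 3, Valued.v ((((d i : (LocalRing L v)ˣ) : LocalRing L v) : LocalRing L v) w) * Valued.v ((((torusEntry (conjLocal L (IsCMField.complexConj L) v) (cmLocalForm L 3 v) i t : (LocalRing L v)ˣ) : LocalRing L v) : LocalRing L v) w) = 1 := fun i => by
      have h1 := v_torusEntry_eq_one_of_mem_cmLocalIntegralLevel L 3 v _ h i w
      rwa [map_mul, hdb, Units.val_mul, Pi.mul_apply, map_mul] at h1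
    have hd' : glDiagonal 3 (LocalRing L v) d = (((⟨b, hbM⟩ : ↥(cmBorelTriple L 3 v).M) : ↥(unitaryGroupOfForm (conjLocal L (IsCMField.complexConj L) v) (cmLocalForm L 3 v))) : GL (Fin 3) (LocalRing L v)) := hd
    obtain ⟨hb02, hb1⟩ := valued_torus_diag_rel L w hw (⟨b, hbM⟩ : ↥(cmBorelTriple L 3 v).M) hd'
    refine ⟨?_, ?_, ?_⟩
    · calc Valued.v ((((torusEntry (conjLocal L (IsCMField.complexConj L) v) (cmLocalForm L 3 v) 0 t : (LocalRing L v)ˣ) : LocalRing L v) : LocalRing L v) w) = (Valued.v ((((d 0 : (LocalRing L v)ˣ) : LocalRing L v) : LocalRing L v) w) * Valued.v ((((d 2 : (LocalRing L v)ˣ) : LocalRing L v) : LocalRing L v) w)) * Valued.v ((((torusEntry (conjLocal L (IsCMField.complexConj L) v) (cmLocalForm L 3 v) 0 t : (LocalRing L v)ˣ) : LocalRing L v) : LocalRing L v) w) := by rw [hb02, one_mul]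
        _ = Valued.v ((((d 2 : (LocalRing L v)ˣ) : LocalRing L v) : LocalRing L v) w) * (Valued.v ((((d 0 : (LocalRing L v)ˣ) : LocalRing L v) : LocalRing L v) w) * Valued.v ((((torusEntry (conjLocal L (IsCMField.complexConj L) v) (cmLocalForm L 3 v) 0 t : (LocalRing L v)ˣ) : LocalRing L v) : LocalRing L v) w)) := by rw [mul_assoc, mul_left_comm]
        _ = Valued.v ((((d 2 : (LocalRing L v)ˣ) : LocalRing L v) : LocalRing L v) w) := by rw [h1 0, mul_one]
    · have := h1 1; rw [hb1, one_mul] at this; rw [this, hb1]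
    · calc Valued.v ((((torusEntry (conjLocal L (IsCMField.complexConj L) v) (cmLocalForm L 3 v) 2 t : (LocalRing L v)ˣ) : LocalRing L v) : LocalRing L v) w) = (Valued.v ((((d 0 : (LocalRing L v)ˣ) : LocalRing L v) : LocalRing L v) w) * Valued.v ((((d 2 : (LocalRing L v)ˣ) : LocalRing L v) : LocalRing L v) w)) * Valued.v ((((torusEntry (conjLocal L (IsCMField.complexConj L) v) (cmLocalForm L 3 v) 2 t : (LocalRing L v)ˣ) : LocalRing L v) : LocalRing L v) w) := by rw [hb02, one_mul]
        _ = Valued.v ((((d 0 : (LocalRing L v)ˣ) : LocalRing L v) : LocalRing L v) w) * (Valued.v ((((d 2 : (LocalRing L v)ˣ) : LocalRing L v) : LocalRing L v) w) * Valued.v ((((torusEntry (conjLocal L (IsCMField.complexConj L) v) (cmLocalForm L 3 v) 2 t : (LocalRing L v)ˣ) : LocalRing L v) : LocalRing L v) w)) := by rw [mul_assoc]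
        _ = Valued.v ((((d 0 : (LocalRing L v)ˣ) : LocalRing L v) : LocalRing L v) w) := by rw [h1 2, mul_one]


/-- **Distinct `w`-valuations make the difference a unit** (`|x − y|_w = max(|x|_w, |y|_w) ≠ 0`). [cite: Rogawski1990, §4.9 p. 55] -/
theorem isUnit_sub_of_valued_apply_ne {v : HeightOneSpectrum (𝓞 ↥(maximalRealSubfield L))} (w : PlacesOver L v) (hw : IsCMField.complexConj L • w.1 = w.1) {x y : LocalRing L v}
    (hxy : Valued.v (x w) ≠ Valued.v (y w)) : IsUnit (x - y) := by
  rw [isUnit_iff_valued_apply_ne_zero L w hw, Pi.sub_apply]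
  have hxy' : Valued.v (x w) ≠ Valued.v (-(y w)) := by rwa [Valuation.map_neg]
  rw [sub_eq_add_neg, Valuation.map_add_of_distinct_val _ hxy', Valuation.map_neg]
  intro hmax
  rcases max_eq_iff.1 hmax with ⟨h0, hle⟩ | ⟨h0, hle⟩
  · exact hxy (le_antisymm (h0.symm ▸ zero_le) (h0.symm ▸ hle))
  · exact hxy (le_antisymm (h0.symm ▸ hle) (h0.symm ▸ zero_le))

set_option maxHeartbeats 1600000 in
/-- **(S2) On `S` the valuations `|t_ii|_w` are pairwise distinct** (`|d₀| < |d₁| < |d₂|` and the two patterns of §3). [cite: Rogawski1990, §4.9 p. 55; §12.7 p. 195] -/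
theorem valued_torusEntry_ne_of_mem_shellTorusSet {v : HeightOneSpectrum (𝓞 ↥(maximalRealSubfield L))} (w : PlacesOver L v) (hw : IsCMField.complexConj L • w.1 = w.1)
    {b : ↥(unitaryGroupOfForm (conjLocal L (IsCMField.complexConj L) v) (cmLocalForm L 3 v))} (hbM : b ∈ (cmBorelTriple L 3 v).M) {d : Fin 3 → (LocalRing L v)ˣ} (hd : glDiagonal 3 (LocalRing L v) d = (b : GL (Fin 3) (LocalRing L v)))
    (h01 : Valued.v ((((d 0 : (LocalRing L v)ˣ) : LocalRing L v) : LocalRing L v) w) < Valued.v ((((d 1 : (LocalRing L v)ˣ) : LocalRing L v) : LocalRing L v) w)) (h12 : Valued.v ((((d 1 : (LocalRing L v)ˣ) : LocalRing L v) : LocalRing L v) w) < Valued.v ((((d 2 : (LocalRing L v)ˣ) : LocalRing L v) : LocalRing L v) w))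
    {t : ↥(cmBorelTriple L 3 v).M} (ht : t ∈ {t : ↥(cmBorelTriple L 3 v).M | (((((⟨b, hbM⟩ : ↥(cmBorelTriple L 3 v).M))⁻¹ * t : ↥(cmBorelTriple L 3 v).M) : ↥(unitaryGroupOfForm (conjLocal L (IsCMField.complexConj L) v) (cmLocalForm L 3 v))) ∈ cmLocalIntegralLevel L 3 (Matrix.of fun i j : Fin 3 => if i.val + j.val + 1 = 3 then (1 : L) else 0) v) ∨ (((((⟨b, hbM⟩ : ↥(cmBorelTriple L 3 v).M)) * t : ↥(cmBorelTriple L 3 v).M) : ↥(unitaryGroupOfForm (conjLocal L (IsCMField.complexConj L) v) (cmLocalForm L 3 v))) ∈ cmLocalIntegralLevel L 3 (Matrix.of fun i j : Fin 3 => if i.val + j.val + 1 = 3 then (1 : L) else 0) v)}) :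
    ∀ i j : Fin 3, i ≠ j → Valued.v ((((torusEntry (conjLocal L (IsCMField.complexConj L) v) (cmLocalForm L 3 v) i t : (LocalRing L v)ˣ) : LocalRing L v) : LocalRing L v) w) ≠ Valued.v ((((torusEntry (conjLocal L (IsCMField.complexConj L) v) (cmLocalForm L 3 v) j t : (LocalRing L v)ˣ) : LocalRing L v) : LocalRing L v) w) := by
  have h02 := h01.trans h12
  have key : Valued.v ((((torusEntry (conjLocal L (IsCMField.complexConj L) v) (cmLocalForm L 3 v) 0 t : (LocalRing L v)ˣ) : LocalRing L v) : LocalRing L v) w) ≠ Valued.v ((((torusEntry (conjLocal L (IsCMField.complexConj L) v) (cmLocalForm L 3 v) 1 t : (LocalRing L v)ˣ) : LocalRing L v) : LocalRing L v) w) ∧ Valued.v ((((torusEntry (conjLocal L (IsCMField.complexConj L) v) (cmLocalForm L 3 v) 0 t : (LocalRing L v)ˣ) : LocalRing L v) : LocalRing L v) w) ≠ Valued.v ((((torusEntry (conjLocal L (IsCMField.complexConj L) v) (cmLocalForm L 3 v) 2 t : (LocalRing L v)ˣ) : LocalRing L v) : LocalRing L v) w) ∧ Valued.v ((((torusEntry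 (conjLocal L (IsCMField.complexConj L) v) (cmLocalForm L 3 v) 1 t : (LocalRing L v)ˣ) : LocalRing L v) : LocalRing L v) w) ≠ Valued.v ((((torusEntry (conjLocal L (IsCMField.complexConj L) v) (cmLocalForm L 3 v) 2 t : (LocalRing L v)ˣ) : LocalRing L v) : LocalRing L v) w) := by
    rcases valued_torusEntry_of_mem_shellTorusSet L w hw hbM hd ht with h | ⟨h0, h1, h2⟩
    · rw [h 0, h 1, h 2]
      exact ⟨ne_of_lt h01, ne_of_lt h02, ne_of_lt h12⟩
    · rw [h0, h1, h2]
      exact ⟨ne_of_gt h12, ne_of_gt h02, ne_of_gt h01⟩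
  obtain ⟨p01, p02, p12⟩ := key
  intro i j hij
  fin_cases i <;> fin_cases j <;> first | exact absurd rfl hij | exact p01 | exact p01.symm | exact p02 | exact p02.symm | exact p12 | exact p12.symm

set_option maxHeartbeats 1600000 in
/-- **(S2a) the unit conditions on `S`**: for every diagonal writing `d′` of `t ∈ S`, `d′₀⁻¹d′₁ − 1` and `d′₀⁻¹d′₂ − 1` are units (the hypothesis `hSunit` of ★ p849763).
[cite: Rogawski1990, §4.9 p. 55] -/
theorem isUnit_torusRatio_sub_one_of_mem_shellTorusSet {v : HeightOneSpectrum (𝓞 ↥(maximalRealSubfield L))} (w : PlacesOver L v) (hw : IsCMField.complexConj L • w.1 = w.1)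
    {b : ↥(unitaryGroupOfForm (conjLocal L (IsCMField.complexConj L) v) (cmLocalForm L 3 v))} (hbM : b ∈ (cmBorelTriple L 3 v).M) {d : Fin 3 → (LocalRing L v)ˣ} (hd : glDiagonal 3 (LocalRing L v) d = (b : GL (Fin 3) (LocalRing L v)))
    (h01 : Valued.v ((((d 0 : (LocalRing L v)ˣ) : LocalRing L v) : LocalRing L v) w) < Valued.v ((((d 1 : (LocalRing L v)ˣ) : LocalRing L v) : LocalRing L v) w)) (h12 : Valued.v ((((d 1 : (LocalRing L v)ˣ) : LocalRing L v) : LocalRing L v) w) < Valued.v ((((d 2 : (LocalRing L v)ˣ) : LocalRing L v) : LocalRing L v) w))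
    {t : ↥(cmBorelTriple L 3 v).M} (ht : t ∈ {t : ↥(cmBorelTriple L 3 v).M | (((((⟨b, hbM⟩ : ↥(cmBorelTriple L 3 v).M))⁻¹ * t : ↥(cmBorelTriple L 3 v).M) : ↥(unitaryGroupOfForm (conjLocal L (IsCMField.complexConj L) v) (cmLocalForm L 3 v))) ∈ cmLocalIntegralLevel L 3 (Matrix.of fun i j : Fin 3 => if i.val + j.val + 1 = 3 then (1 : L) else 0) v) ∨ (((((⟨b, hbM⟩ : ↥(cmBorelTriple L 3 v).M)) * t : ↥(cmBorelTriple L 3 v).M) : ↥(unitaryGroupOfForm (conjLocal L (IsCMField.complexConj L) v) (cmLocalForm L 3 v))) ∈ cmLocalIntegralLevel L 3 (Matrix.of fun i j : Fin 3 => if i.val + j.val + 1 = 3 then (1 : L) else 0) v)}) (d' : Fin 3 → (LocalRing L v)ˣ) (hd' : glDiagonal 3 (LocalRing L v) d' = ((t : ↥(unitaryGroupOfForm (conjLocal L (IsCMField.complexConj L) v) (cmLocalForm L 3 v))) : GL (Fin 3) (LocalRing L v))) :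
    IsUnit ((((d' 0)⁻¹ * d' 1 : (LocalRing L v)ˣ) : LocalRing L v) - 1) ∧ IsUnit ((((d' 0)⁻¹ * d' 2 : (LocalRing L v)ˣ) : LocalRing L v) - 1) := by
  have hne := valued_torusEntry_ne_of_mem_shellTorusSet L w hw hbM hd h01 h12 ht
  obtain rfl := eq_torusEntry_of_glDiagonal_eq L v t d' hd'
  have key : ∀ j : Fin 3, 0 ≠ j → IsUnit ((((torusEntry (conjLocal L (IsCMField.complexConj L) v) (cmLocalForm L 3 v) 0 t)⁻¹ * torusEntry (conjLocal L (IsCMField.complexConj L) v) (cmLocalForm L 3 v) j t : (LocalRing L v)ˣ) : LocalRing L v) - 1) := fun j hj => by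
    have e : ((((torusEntry (conjLocal L (IsCMField.complexConj L) v) (cmLocalForm L 3 v) 0 t)⁻¹ * torusEntry (conjLocal L (IsCMField.complexConj L) v) (cmLocalForm L 3 v) j t : (LocalRing L v)ˣ) : LocalRing L v) - 1) =
        (((torusEntry (conjLocal L (IsCMField.complexConj L) v) (cmLocalForm L 3 v) 0 t)⁻¹ : (LocalRing L v)ˣ) : LocalRing L v) * (((torusEntry (conjLocal L (IsCMField.complexConj L) v) (cmLocalForm L 3 v) j t : (LocalRing L v)ˣ) : LocalRing L v) - ((torusEntry (conjLocal L (IsCMField.complexConj L) v) (cmLocalForm L 3 v) 0 t : (LocalRing L v)ˣ) : LocalRing L v)) := by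
      rw [Units.val_mul, mul_sub, Units.inv_mul]
    rw [e]
    exact (Units.isUnit _).mul (isUnit_sub_of_valued_apply_ne L w hw (hne j 0 hj.symm))
  exact ⟨key 1 (by decide), key 2 (by decide)⟩

set_option maxHeartbeats 1600000 in
/-- **(S2b) regularity on `S`**: `charpoly t = ∏ (X − t_ii)` with pairwise unit differences is separable, so `t` — and `e t` for any frame `e` (★ `isRegularElt_conj_iff`) — is
regular semisimple (the hypothesis `hSreg` of ★ p849763). [cite: Rogawski1990, §3.1 p. 19; §4.9 p. 55] -/
theorem isRegularElt_frame_of_mem_shellTorusSet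
    (H : Matrix (Fin 3) (Fin 3) L) {v : HeightOneSpectrum (𝓞 ↥(maximalRealSubfield L))} (w : PlacesOver L v) (hw : IsCMField.complexConj L • w.1 = w.1)
    (T : GL (Fin 3) (LocalRing L v)) {a : LocalRing L v} (ha : IsUnit a)
    (h : formCongr (conjLocal L (IsCMField.complexConj L) v) T (H.map (algebraMap L (LocalRing L v))) =
      a • (Matrix.of fun i j : Fin 3 => if i.val + j.val + 1 = 3 then (1 : L) else 0).map (algebraMap L (LocalRing L v)))
    {b : ↥(unitaryGroupOfForm (conjLocal L (IsCMField.complexConj L) v) (cmLocalForm L 3 v))} (hbM : b ∈ (cmBorelTriple L 3 v).M) {d : Fin 3 → (LocalRing L v)ˣ} (hd : glDiagonal 3 (LocalRing L v) d = (b : GL (Fin 3) (LocalRing L v)))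
    (h01 : Valued.v ((((d 0 : (LocalRing L v)ˣ) : LocalRing L v) : LocalRing L v) w) < Valued.v ((((d 1 : (LocalRing L v)ˣ) : LocalRing L v) : LocalRing L v) w)) (h12 : Valued.v ((((d 1 : (LocalRing L v)ˣ) : LocalRing L v) : LocalRing L v) w) < Valued.v ((((d 2 : (LocalRing L v)ˣ) : LocalRing L v) : LocalRing L v) w))
    {t : ↥(cmBorelTriple L 3 v).M} (ht : t ∈ {t : ↥(cmBorelTriple L 3 v).M | (((((⟨b, hbM⟩ : ↥(cmBorelTriple L 3 v).M))⁻¹ * t : ↥(cmBorelTriple L 3 v).M) : ↥(unitaryGroupOfForm (conjLocal L (IsCMField.complexConj L) v) (cmLocalForm L 3 v))) ∈ cmLocalIntegralLevel L 3 (Matrix.of fun i j : Fin 3 => if i.val + j.val + 1 = 3 then (1 : L) else 0) v) ∨ (((((⟨b, hbM⟩ : ↥(cmBorelTriple L 3 v).M)) * t : ↥(cmBorelTriple L 3 v).M) : ↥(unitaryGroupOfForm (conjLocal L (IsCMField.complexConj L) v) (cmLocalForm L 3 v))) ∈ cmLocalIntegralLevel L 3 (Matrix.of fun i j : Fin 3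 => if i.val + j.val + 1 = 3 then (1 : L) else 0) v)}) :
    IsRegularElt ((Subtype.val ((cmDatumLocalCongr L v T ha h) (t : ↥(unitaryGroupOfForm (conjLocal L (IsCMField.complexConj L) v) (cmLocalForm L 3 v))))) : GL (Fin 3) (LocalRing L v)) := by
  have hne := valued_torusEntry_ne_of_mem_shellTorusSet L w hw hbM hd h01 h12 ht
  have hval : ((Subtype.val ((cmDatumLocalCongr L v T ha h) (t : ↥(unitaryGroupOfForm (conjLocal L (IsCMField.complexConj L) v) (cmLocalForm L 3 v))))) : GL (Fin 3) (LocalRing L v)) = T * ((t : ↥(unitaryGroupOfForm (conjLocal L (IsCMField.complexConj L) v) (cmLocalForm L 3 v))) : GL (Fin 3) (LocalRing L v)) * T⁻¹ := rfl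
  rw [hval, isRegularElt_conj_iff, isRegularElt_iff]
  have hmat : ((t : ↥(unitaryGroupOfForm (conjLocal L (IsCMField.complexConj L) v) (cmLocalForm L 3 v))) : GL (Fin 3) (LocalRing L v)).val =
      Matrix.diagonal fun k => ((torusEntry (conjLocal L (IsCMField.complexConj L) v) (cmLocalForm L 3 v) k t : (LocalRing L v)ˣ) : LocalRing L v) := by
    rw [← glDiagonal_torusEntry_eq L v t, coe_glDiagonal]
  rw [hmat, Matrix.charpoly_diagonal]
  refine Polynomial.separable_prod (fun i j hij => ?_) fun i => Polynomial.separable_X_sub_C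
  exact Polynomial.isCoprime_X_sub_C_of_isUnit_sub (isUnit_sub_of_valued_apply_ne L w hw (hne i j hij))

/-! ## §4 A shell element with the characteristic polynomial of `t ∈ M` forces `t ∈ S` -/

set_option maxHeartbeats 3200000 in
/-- **(S3) THE VALUATION PATTERN OF A TORUS ELEMENT CONJUGATE INTO THE SHELL.**  `K ≤ U(Φ₃)(L⁺_v)` with `|k_ij − δ_ij|_w ≤ r < 1` on `K`, `b = diag(d) ∈ M` with
`|d₀|_w < |d₁|_w < |d₂|_w`; if `g ∈ K b K` and `t ∈ M` have the same characteristic polynomial then `t ∈ S` (★ D3-i at the place `w`, then the torus relations).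
[cite: Rogawski1990, §12.7 L. 12.7.3 (proof) p. 195] [cite: Casselman1995, §1.5] -/
theorem mem_shellTorusSet_of_charpoly_eq {v : HeightOneSpectrum (𝓞 ↥(maximalRealSubfield L))} (w : PlacesOver L v) (hw : IsCMField.complexConj L • w.1 = w.1)
    (K : Subgroup ↥(unitaryGroupOfForm (conjLocal L (IsCMField.complexConj L) v) (cmLocalForm L 3 v))) {r : WithZero (Multiplicative ℤ)} (hr : r < 1)
    (hKr : ∀ k ∈ K, ∀ i j : Fin 3, Valued.v ((((k : GL (Fin 3) (LocalRing L v)).val i j - (1 : Matrix (Fin 3) (Fin 3) (LocalRing L v)) i j) : LocalRing L v) w) ≤ r)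
    {b : ↥(unitaryGroupOfForm (conjLocal L (IsCMField.complexConj L) v) (cmLocalForm L 3 v))} (hbM : b ∈ (cmBorelTriple L 3 v).M) {d : Fin 3 → (LocalRing L v)ˣ} (hd : glDiagonal 3 (LocalRing L v) d = (b : GL (Fin 3) (LocalRing L v)))
    (h01 : Valued.v ((((d 0 : (LocalRing L v)ˣ) : LocalRing L v) : LocalRing L v) w) < Valued.v ((((d 1 : (LocalRing L v)ˣ) : LocalRing L v) : LocalRing L v) w)) (h12 : Valued.v ((((d 1 : (LocalRing L v)ˣ) : LocalRing L v) : LocalRing L v) w) < Valued.v ((((d 2 : (LocalRing L v)ˣ) : LocalRing L v) : LocalRing L v) w))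
    {g : ↥(unitaryGroupOfForm (conjLocal L (IsCMField.complexConj L) v) (cmLocalForm L 3 v))} (hg : g ∈ DoubleCoset.doubleCoset b (K : Set ↥(unitaryGroupOfForm (conjLocal L (IsCMField.complexConj L) v) (cmLocalForm L 3 v))) (K : Set ↥(unitaryGroupOfForm (conjLocal L (IsCMField.complexConj L) v) (cmLocalForm L 3 v)))) (t : ↥(cmBorelTriple L 3 v).M)
    (hchar : ((g : GL (Fin 3) (LocalRing L v)).val).charpoly = (((t : ↥(unitaryGroupOfForm (conjLocal L (IsCMField.complexConj L) v) (cmLocalForm L 3 v))) : GL (Fin 3) (LocalRing L v)).val).charpoly) :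
    t ∈ {t : ↥(cmBorelTriple L 3 v).M | (((((⟨b, hbM⟩ : ↥(cmBorelTriple L 3 v).M))⁻¹ * t : ↥(cmBorelTriple L 3 v).M) : ↥(unitaryGroupOfForm (conjLocal L (IsCMField.complexConj L) v) (cmLocalForm L 3 v))) ∈ cmLocalIntegralLevel L 3 (Matrix.of fun i j : Fin 3 => if i.val + j.val + 1 = 3 then (1 : L) else 0) v) ∨ (((((⟨b, hbM⟩ : ↥(cmBorelTriple L 3 v).M)) * t : ↥(cmBorelTriple L 3 v).M) : ↥(unitaryGroupOfForm (conjLocal L (IsCMField.complexConj L) v) (cmLocalForm L 3 v))) ∈ cmLocalIntegralLevel L 3 (Matrix.of fun i j : Fin 3 => if i.val + j.val + 1 = 3 then (1 : L) else 0) v)} := by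
  obtain ⟨k₁, hk₁, k₂, hk₂, rfl⟩ := DoubleCoset.mem_doubleCoset.1 hg
  -- evaluate at the place `w`
  set φ : LocalRing L v →+* w.1.adicCompletion L := Pi.evalRingHom (fun w' : PlacesOver L v => w'.1.adicCompletion L) w with hφ
  have hφa : ∀ x : LocalRing L v, φ x = x w := fun x => rfl
  have hone : ∀ i j : Fin 3, φ ((1 : Matrix (Fin 3) (Fin 3) (LocalRing L v)) i j) = (1 : Matrix (Fin 3) (Fin 3) (w.1.adicCompletion L)) i j := by
    intro i j; rw [Matrix.one_apply, Matrix.one_apply]; split_ifs <;> simp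
  have hk : ∀ k ∈ K, ∀ i j : Fin 3, Valued.v ((((k : GL (Fin 3) (LocalRing L v)).val.map φ) i j - (1 : Matrix (Fin 3) (Fin 3) (w.1.adicCompletion L)) i j)) ≤ r := by
    intro k hk i j
    rw [Matrix.map_apply, ← hone, ← map_sub, hφa]
    exact hKr k hk i j
  have hmat_t : ((t : ↥(unitaryGroupOfForm (conjLocal L (IsCMField.complexConj L) v) (cmLocalForm L 3 v))) : GL (Fin 3) (LocalRing L v)).val =
      Matrix.diagonal fun k => ((torusEntry (conjLocal L (IsCMField.complexConj L) v) (cmLocalForm L 3 v) k t : (LocalRing L v)ˣ) : LocalRing L v) := by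
    rw [← glDiagonal_torusEntry_eq L v t, coe_glDiagonal]
  have hmat_b : (b : GL (Fin 3) (LocalRing L v)).val = Matrix.diagonal fun k => ((d k : (LocalRing L v)ˣ) : LocalRing L v) := by
    rw [← hd, coe_glDiagonal]
  have hdiag : ∀ c : Fin 3 → LocalRing L v, (Matrix.diagonal c).map φ = Matrix.diagonal fun k => φ (c k) := fun c =>
    Matrix.diagonal_map (map_zero φ)
  have hchar' : (Matrix.diagonal fun k => φ (((torusEntry (conjLocal L (IsCMField.complexConj L) v) (cmLocalForm L 3 v) k t : (LocalRing L v)ˣ) : LocalRing L v))).charpoly =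
      (((k₁ : GL (Fin 3) (LocalRing L v)).val.map φ) * Matrix.diagonal (fun k => φ ((d k : (LocalRing L v)ˣ) : LocalRing L v)) *
        ((k₂ : GL (Fin 3) (LocalRing L v)).val.map φ)).charpoly := by
    rw [← hdiag, ← hdiag, ← hmat_t, ← hmat_b, ← Matrix.map_mul, ← Matrix.map_mul, Matrix.charpoly_map, Matrix.charpoly_map, ← hchar]
    rfl
  obtain ⟨-, -, ⟨i₂, hi₂⟩, -⟩ := F0P3cStCharTSShellRoots.valuation_extremes_of_charpoly_diagonal_eq_shell
    (Valued.v : Valuation (w.1.adicCompletion L) (WithZero (Multiplicative ℤ)))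
    (fun k => φ (((torusEntry (conjLocal L (IsCMField.complexConj L) v) (cmLocalForm L 3 v) k t : (LocalRing L v)ˣ) : LocalRing L v))) (fun k => φ ((d k : (LocalRing L v)ˣ) : LocalRing L v)) _ _ hr
    (hk k₁ hk₁) (hk k₂ hk₂) (by rw [hφa]; exact valued_apply_ne_zero_of_isUnit L v (d 0).isUnit w) (by rw [hφa, hφa]; exact h01)
    (by rw [hφa, hφa]; exact h12) hchar'
  simp only [hφa] at hi₂
  -- torus relations for `t` and for `b`
  have hd' : glDiagonal 3 (LocalRing L v) d = (((⟨b, hbM⟩ : ↥(cmBorelTriple L 3 v).M) : ↥(unitaryGroupOfForm (conjLocal L (IsCMField.complexConj L) v) (cmLocalForm L 3 v))) : GL (Fin 3) (LocalRing L v)) := hd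
  obtain ⟨hb02, hb1⟩ := valued_torus_diag_rel L w hw (⟨b, hbM⟩ : ↥(cmBorelTriple L 3 v).M) hd'
  obtain ⟨ht02, ht1⟩ := valued_torus_diag_rel L w hw t (glDiagonal_torusEntry_eq L v t)
  have hdb : ∀ i : Fin 3, torusEntry (conjLocal L (IsCMField.complexConj L) v) (cmLocalForm L 3 v) i (⟨b, hbM⟩ : ↥(cmBorelTriple L 3 v).M) = d i := fun i => torusEntry_eq_of_glDiagonal_eq (conjLocal L (IsCMField.complexConj L) v) (cmLocalForm L 3 v) i _ d hd
  have hd1 : 1 < Valued.v ((((d 2 : (LocalRing L v)ˣ) : LocalRing L v) : LocalRing L v) w) := hb1 ▸ h12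
  fin_cases i₂
  · -- `|t₀₀| = |d₂|`: the pattern of `bʷ`, `b t ∈ K_v`
    right
    have ht0 : Valued.v ((((torusEntry (conjLocal L (IsCMField.complexConj L) v) (cmLocalForm L 3 v) 0 t : (LocalRing L v)ˣ) : LocalRing L v) : LocalRing L v) w) = Valued.v ((((d 2 : (LocalRing L v)ˣ) : LocalRing L v) : LocalRing L v) w) := hi₂
    have ht2 : Valued.v ((((torusEntry (conjLocal L (IsCMField.complexConj L) v) (cmLocalForm L 3 v) 2 t : (LocalRing L v)ˣ) : LocalRing L v) : LocalRing L v) w) = Valued.v ((((d 0 : (LocalRing L v)ˣ) : LocalRing L v) : LocalRing L v) w) := by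
      have e1 : Valued.v ((((torusEntry (conjLocal L (IsCMField.complexConj L) v) (cmLocalForm L 3 v) 2 t : (LocalRing L v)ˣ) : LocalRing L v) : LocalRing L v) w) = (Valued.v ((((torusEntry (conjLocal L (IsCMField.complexConj L) v) (cmLocalForm L 3 v) 0 t : (LocalRing L v)ˣ) : LocalRing L v) : LocalRing L v) w))⁻¹ := eq_inv_of_mul_eq_one_right ht02
      have e2 : Valued.v ((((d 0 : (LocalRing L v)ˣ) : LocalRing L v) : LocalRing L v) w) = (Valued.v ((((d 2 : (LocalRing L v)ˣ) : LocalRing L v) : LocalRing L v) w))⁻¹ := eq_inv_of_mul_eq_one_left hb02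
      rw [e1, e2, ht0]
    refine coe_mem_cmLocalIntegralLevel_of_valued_torusEntry_eq_one L w hw _ fun i => ?_
    rw [map_mul, hdb, Units.val_mul, Pi.mul_apply, map_mul]
    fin_cases i
    · show Valued.v ((((d 0 : (LocalRing L v)ˣ) : LocalRing L v) : LocalRing L v) w) * Valued.v ((((torusEntry (conjLocal L (IsCMField.complexConj L) v) (cmLocalForm L 3 v) 0 t : (LocalRing L v)ˣ) : LocalRing L v) : LocalRing L v) w) = 1
      rw [ht0, hb02]
    · show Valued.v ((((d 1 : (LocalRing L v)ˣ) : LocalRing L v) : LocalRing L v) w) * Valued.v ((((torusEntry (conjLocal L (IsCMField.complexConj L) v) (cmLocalForm L 3 v) 1 t : (LocalRing L v)ˣ) : LocalRing L v) : LocalRing L v) w) = 1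
      rw [ht1, hb1, mul_one]
    · show Valued.v ((((d 2 : (LocalRing L v)ˣ) : LocalRing L v) : LocalRing L v) w) * Valued.v ((((torusEntry (conjLocal L (IsCMField.complexConj L) v) (cmLocalForm L 3 v) 2 t : (LocalRing L v)ˣ) : LocalRing L v) : LocalRing L v) w) = 1
      rw [ht2, mul_comm, hb02]
  · -- `|t₁₁| = |d₂| > 1`: impossible
    exact absurd (ht1.symm.trans hi₂) (ne_of_lt hd1)
  · -- `|t₂₂| = |d₂|`: the pattern of `b`, `b⁻¹ t ∈ K_v`
    left
    have ht2 : Valued.v ((((torusEntry (conjLocal L (IsCMField.complexConj L) v) (cmLocalForm L 3 v) 2 t : (LocalRing L v)ˣ) : LocalRing L v) : LocalRing L v) w) = Valued.v ((((d 2 : (LocalRing L v)ˣ) : LocalRing L v) : LocalRing L v) w) := hi₂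
    have ht0 : Valued.v ((((torusEntry (conjLocal L (IsCMField.complexConj L) v) (cmLocalForm L 3 v) 0 t : (LocalRing L v)ˣ) : LocalRing L v) : LocalRing L v) w) = Valued.v ((((d 0 : (LocalRing L v)ˣ) : LocalRing L v) : LocalRing L v) w) := by
      have e1 : Valued.v ((((torusEntry (conjLocal L (IsCMField.complexConj L) v) (cmLocalForm L 3 v) 0 t : (LocalRing L v)ˣ) : LocalRing L v) : LocalRing L v) w) = (Valued.v ((((torusEntry (conjLocal L (IsCMField.complexConj L) v) (cmLocalForm L 3 v) 2 t : (LocalRing L v)ˣ) : LocalRing L v) : LocalRing L v) w))⁻¹ := eq_inv_of_mul_eq_one_left ht02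
      have e2 : Valued.v ((((d 0 : (LocalRing L v)ˣ) : LocalRing L v) : LocalRing L v) w) = (Valued.v ((((d 2 : (LocalRing L v)ˣ) : LocalRing L v) : LocalRing L v) w))⁻¹ := eq_inv_of_mul_eq_one_left hb02
      rw [e1, e2, ht2]
    have hne : ∀ i : Fin 3, Valued.v ((((d i : (LocalRing L v)ˣ) : LocalRing L v) : LocalRing L v) w) ≠ 0 := fun i => valued_apply_ne_zero_of_isUnit L v (d i).isUnit w
    refine coe_mem_cmLocalIntegralLevel_of_valued_torusEntry_eq_one L w hw _ fun i => ?_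
    rw [map_mul, map_inv, hdb, Units.val_mul, Units.val_inv_eq_inv_val, Pi.mul_apply, Pi.inv_apply, map_mul, map_inv₀]
    fin_cases i
    · show (Valued.v ((((d 0 : (LocalRing L v)ˣ) : LocalRing L v) : LocalRing L v) w))⁻¹ * Valued.v ((((torusEntry (conjLocal L (IsCMField.complexConj L) v) (cmLocalForm L 3 v) 0 t : (LocalRing L v)ˣ) : LocalRing L v) : LocalRing L v) w) = 1
      rw [ht0, inv_mul_cancel₀ (hne 0)]
    · show (Valued.v ((((d 1 : (LocalRing L v)ˣ) : LocalRing L v) : LocalRing L v) w))⁻¹ * Valued.v ((((torusEntry (conjLocal L (IsCMField.complexConj L) v) (cmLocalForm L 3 v) 1 t : (LocalRing L v)ˣ) : LocalRing L v) : LocalRing L v) w) = 1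
      rw [ht1, hb1, inv_one, mul_one]
    · show (Valued.v ((((d 2 : (LocalRing L v)ˣ) : LocalRing L v) : LocalRing L v) w))⁻¹ * Valued.v ((((torusEntry (conjLocal L (IsCMField.complexConj L) v) (cmLocalForm L 3 v) 2 t : (LocalRing L v)ˣ) : LocalRing L v) : LocalRing L v) w) = 1
      rw [ht2, inv_mul_cancel₀ (hne 2)]

/-! ## §5 The support statements (`hSoff` of ★ p849763) and the bundle -/

set_option maxHeartbeats 1600000 in
/-- **(S3a) OFF `S` NO CONJUGATE MEETS THE SHELL**: for `t ∉ S` and every `x`, `x t x⁻¹ ∉ tsupport 𝟙_{K b K}` (`= K b K`, closed since `K` is compact).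
[cite: Rogawski1990, §12.7 L. 12.7.3 (proof) p. 195; §4.9 p. 55] -/
theorem conj_notMem_tsupport_indicator_shell_of_notMem {v : HeightOneSpectrum (𝓞 ↥(maximalRealSubfield L))} (w : PlacesOver L v) (hw : IsCMField.complexConj L • w.1 = w.1)
    (K : Subgroup ↥(unitaryGroupOfForm (conjLocal L (IsCMField.complexConj L) v) (cmLocalForm L 3 v))) (hKc : IsCompact (K : Set ↥(unitaryGroupOfForm (conjLocal L (IsCMField.complexConj L) v) (cmLocalForm L 3 v)))) {r : WithZero (Multiplicative ℤ)} (hr : r < 1)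
    (hKr : ∀ k ∈ K, ∀ i j : Fin 3, Valued.v ((((k : GL (Fin 3) (LocalRing L v)).val i j - (1 : Matrix (Fin 3) (Fin 3) (LocalRing L v)) i j) : LocalRing L v) w) ≤ r)
    {b : ↥(unitaryGroupOfForm (conjLocal L (IsCMField.complexConj L) v) (cmLocalForm L 3 v))} (hbM : b ∈ (cmBorelTriple L 3 v).M) {d : Fin 3 → (LocalRing L v)ˣ} (hd : glDiagonal 3 (LocalRing L v) d = (b : GL (Fin 3) (LocalRing L v)))
    (h01 : Valued.v ((((d 0 : (LocalRing L v)ˣ) : LocalRing L v) : LocalRing L v) w) < Valued.v ((((d 1 : (LocalRing L v)ˣ) : LocalRing L v) : LocalRing L v) w)) (h12 : Valued.v ((((d 1 : (LocalRing L v)ˣ) : LocalRing L v) : LocalRing L v) w) < Valued.v ((((d 2 : (LocalRing L v)ˣ) : LocalRing L v) : LocalRing L v) w))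
    (t : ↥(cmBorelTriple L 3 v).M) (ht : t ∉ {t : ↥(cmBorelTriple L 3 v).M | (((((⟨b, hbM⟩ : ↥(cmBorelTriple L 3 v).M))⁻¹ * t : ↥(cmBorelTriple L 3 v).M) : ↥(unitaryGroupOfForm (conjLocal L (IsCMField.complexConj L) v) (cmLocalForm L 3 v))) ∈ cmLocalIntegralLevel L 3 (Matrix.of fun i j : Fin 3 => if i.val + j.val + 1 = 3 then (1 : L) else 0) v) ∨ (((((⟨b, hbM⟩ : ↥(cmBorelTriple L 3 v).M)) * t : ↥(cmBorelTriple L 3 v).M) : ↥(unitaryGroupOfForm (conjLocal L (IsCMField.complexConj L) v) (cmLocalForm L 3 v))) ∈ cmLocalIntegralLevel L 3 (Matrix.of fun i j : Fin 3 => if i.val + j.val + 1 = 3 then (1 : L) else 0) v)}) (x : ↥(unitaryGroupOfForm (conjLocal L (IsCMField.complexConj L) v) (cmLocalForm L 3 v))) :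
    x * (t : ↥(unitaryGroupOfForm (conjLocal L (IsCMField.complexConj L) v) (cmLocalForm L 3 v))) * x⁻¹ ∉ tsupport ((DoubleCoset.doubleCoset b (K : Set ↥(unitaryGroupOfForm (conjLocal L (IsCMField.complexConj L) v) (cmLocalForm L 3 v))) (K : Set ↥(unitaryGroupOfForm (conjLocal L (IsCMField.complexConj L) v) (cmLocalForm L 3 v)))).indicator fun _ => (1 : ℂ)) := by
  have hclosed : IsClosed (DoubleCoset.doubleCoset b (K : Set ↥(unitaryGroupOfForm (conjLocal L (IsCMField.complexConj L) v) (cmLocalForm L 3 v))) (K : Set ↥(unitaryGroupOfForm (conjLocal L (IsCMField.complexConj L) v) (cmLocalForm L 3 v)))) :=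
    ((hKc.mul isCompact_singleton).mul hKc).isClosed
  have hsub : tsupport ((DoubleCoset.doubleCoset b (K : Set ↥(unitaryGroupOfForm (conjLocal L (IsCMField.complexConj L) v) (cmLocalForm L 3 v))) (K : Set ↥(unitaryGroupOfForm (conjLocal L (IsCMField.complexConj L) v) (cmLocalForm L 3 v)))).indicator fun _ => (1 : ℂ)) ⊆
      DoubleCoset.doubleCoset b (K : Set ↥(unitaryGroupOfForm (conjLocal L (IsCMField.complexConj L) v) (cmLocalForm L 3 v))) (K : Set ↥(unitaryGroupOfForm (conjLocal L (IsCMField.complexConj L) v) (cmLocalForm L 3 v))) := by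
    rw [tsupport]
    exact closure_minimal Set.support_indicator_subset hclosed
  intro hmem
  refine ht (mem_shellTorusSet_of_charpoly_eq L w hw K hr hKr hbM hd h01 h12 (hsub hmem) t ?_)
  rw [Subgroup.coe_mul, Subgroup.coe_mul, Subgroup.coe_inv, Units.val_mul, Units.val_mul, Matrix.coe_units_inv, Matrix.charpoly_units_conj]

set_option maxHeartbeats 1600000 in
/-- **(S3b) the same through a frame `e`**: if `tsupport F ⊆ e(K b K)` then for `t ∉ S` no conjugate of `e t` lies in `tsupport F` (the hypothesis `hSoff` of ★ p849763 for
the transported shell indicator). [cite: Rogawski1990, §12.7 L. 12.7.3 (proof) p. 195; §4.3 p. 42] -/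
theorem conj_frame_notMem_tsupport_of_notMem
    (H : Matrix (Fin 3) (Fin 3) L) {v : HeightOneSpectrum (𝓞 ↥(maximalRealSubfield L))} (w : PlacesOver L v) (hw : IsCMField.complexConj L • w.1 = w.1)
    (T : GL (Fin 3) (LocalRing L v)) {a : LocalRing L v} (ha : IsUnit a)
    (h : formCongr (conjLocal L (IsCMField.complexConj L) v) T (H.map (algebraMap L (LocalRing L v))) =
      a • (Matrix.of fun i j : Fin 3 => if i.val + j.val + 1 = 3 then (1 : L) else 0).map (algebraMap L (LocalRing L v)))
    (K : Subgroup ↥(unitaryGroupOfForm (conjLocal L (IsCMField.complexConj L) v) (cmLocalForm L 3 v))) {r : WithZero (Multiplicative ℤ)} (hr : r < 1)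
    (hKr : ∀ k ∈ K, ∀ i j : Fin 3, Valued.v ((((k : GL (Fin 3) (LocalRing L v)).val i j - (1 : Matrix (Fin 3) (Fin 3) (LocalRing L v)) i j) : LocalRing L v) w) ≤ r)
    {b : ↥(unitaryGroupOfForm (conjLocal L (IsCMField.complexConj L) v) (cmLocalForm L 3 v))} (hbM : b ∈ (cmBorelTriple L 3 v).M) {d : Fin 3 → (LocalRing L v)ˣ} (hd : glDiagonal 3 (LocalRing L v) d = (b : GL (Fin 3) (LocalRing L v)))
    (h01 : Valued.v ((((d 0 : (LocalRing L v)ˣ) : LocalRing L v) : LocalRing L v) w) < Valued.v ((((d 1 : (LocalRing L v)ˣ) : LocalRing L v) : LocalRing L v) w)) (h12 : Valued.v ((((d 1 : (LocalRing L v)ˣ) : LocalRing L v) : LocalRing L v) w) < Valued.v ((((d 2 : (LocalRing L v)ˣ) : LocalRing L v) : LocalRing L v) w))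
    {F : ((cmDatum L 3 H).Local v) → ℂ} (hF : tsupport F ⊆ (cmDatumLocalCongr L v T ha h) '' DoubleCoset.doubleCoset b (K : Set ↥(unitaryGroupOfForm (conjLocal L (IsCMField.complexConj L) v) (cmLocalForm L 3 v))) (K : Set ↥(unitaryGroupOfForm (conjLocal L (IsCMField.complexConj L) v) (cmLocalForm L 3 v))))
    (t : ↥(cmBorelTriple L 3 v).M) (ht : t ∉ {t : ↥(cmBorelTriple L 3 v).M | (((((⟨b, hbM⟩ : ↥(cmBorelTriple L 3 v).M))⁻¹ * t : ↥(cmBorelTriple L 3 v).M) : ↥(unitaryGroupOfForm (conjLocal L (IsCMField.complexConj L) v) (cmLocalForm L 3 v))) ∈ cmLocalIntegralLevel L 3 (Matrix.of fun i j : Fin 3 => if i.val + j.val + 1 = 3 then (1 : L) else 0) v) ∨ (((((⟨b, hbM⟩ : ↥(cmBorelTriple L 3 v).M)) * t : ↥(cmBorelTriple L 3 v).M) : ↥(unitaryGroupOfForm (conjLocal L (IsCMField.complexConj L) v) (cmLocalForm L 3 v))) ∈ cmLocalIntegralLevel L 3 (Matrix.of fun i j : Fin 3 => if i.val + j.val +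 1 = 3 then (1 : L) else 0) v)}) (x : ((cmDatum L 3 H).Local v)) :
    x * (cmDatumLocalCongr L v T ha h) (t : ↥(unitaryGroupOfForm (conjLocal L (IsCMField.complexConj L) v) (cmLocalForm L 3 v))) * x⁻¹ ∉ tsupport F := by
  intro hmem
  obtain ⟨g, hg, hgx⟩ := hF hmem
  refine ht (mem_shellTorusSet_of_charpoly_eq L w hw K hr hKr hbM hd h01 h12 hg t ?_)
  have h1 : ((Subtype.val ((cmDatumLocalCongr L v T ha h) g)) : GL (Fin 3) (LocalRing L v)) = T * g.val * T⁻¹ := rfl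
  have h2 : ((Subtype.val (x * (cmDatumLocalCongr L v T ha h) (t : ↥(unitaryGroupOfForm (conjLocal L (IsCMField.complexConj L) v) (cmLocalForm L 3 v))) * x⁻¹)) : GL (Fin 3) (LocalRing L v)) =
      x.val * (T * ((t : ↥(unitaryGroupOfForm (conjLocal L (IsCMField.complexConj L) v) (cmLocalForm L 3 v))) : GL (Fin 3) (LocalRing L v)) * T⁻¹) * x.val⁻¹ := rfl
  have h3 := congrArg (fun y : ((cmDatum L 3 H).Local v) => (y.val : GL (Fin 3) (LocalRing L v)).val.charpoly) hgx
  simp only [h1, h2, Units.val_mul, Matrix.coe_units_inv, Matrix.charpoly_units_conj] at h3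
  exact h3

/-- **«S-SHELL» — THE BUNDLE** in the currency of ★ p849763 `exists_normalizedOrbitalIntegral_isLocallyConstant_hasCompactSupport`: for the shell `K b K` the set
`S = {t ∈ M ∣ b⁻¹t ∈ K_v ∨ bt ∈ K_v}` supplies `hSc`, `hSreg` (any frame `e`), `hSunit`, and `hSoff` (plain, and through `e` for any `F` with `tsupport F ⊆ e(KbK)`).
[cite: Rogawski1990, §12.7 L. 12.7.3 (proof) p. 195; §4.9 pp. 55–56] -/
theorem shellTorusSet_spec
    (H : Matrix (Fin 3) (Fin 3) L) {v : HeightOneSpectrum (𝓞 ↥(maximalRealSubfield L))} (w : PlacesOver L v) (hw : IsCMField.complexConj L • w.1 = w.1)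
    (T : GL (Fin 3) (LocalRing L v)) {a : LocalRing L v} (ha : IsUnit a)
    (h : formCongr (conjLocal L (IsCMField.complexConj L) v) T (H.map (algebraMap L (LocalRing L v))) =
      a • (Matrix.of fun i j : Fin 3 => if i.val + j.val + 1 = 3 then (1 : L) else 0).map (algebraMap L (LocalRing L v)))
    (K : Subgroup ↥(unitaryGroupOfForm (conjLocal L (IsCMField.complexConj L) v) (cmLocalForm L 3 v))) (hKc : IsCompact (K : Set ↥(unitaryGroupOfForm (conjLocal L (IsCMField.complexConj L) v) (cmLocalForm L 3 v)))) {r : WithZero (Multiplicative ℤ)} (hr : r < 1)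
    (hKr : ∀ k ∈ K, ∀ i j : Fin 3, Valued.v ((((k : GL (Fin 3) (LocalRing L v)).val i j - (1 : Matrix (Fin 3) (Fin 3) (LocalRing L v)) i j) : LocalRing L v) w) ≤ r)
    {b : ↥(unitaryGroupOfForm (conjLocal L (IsCMField.complexConj L) v) (cmLocalForm L 3 v))} (hbM : b ∈ (cmBorelTriple L 3 v).M) {d : Fin 3 → (LocalRing L v)ˣ} (hd : glDiagonal 3 (LocalRing L v) d = (b : GL (Fin 3) (LocalRing L v)))
    (h01 : Valued.v ((((d 0 : (LocalRing L v)ˣ) : LocalRing L v) : LocalRing L v) w) < Valued.v ((((d 1 : (LocalRing L v)ˣ) : LocalRing L v) : LocalRing L v) w)) (h12 : Valued.v ((((d 1 : (LocalRing L v)ˣ) : LocalRing L v) : LocalRing L v) w) < Valued.v ((((d 2 : (LocalRing L v)ˣ) : LocalRing L v) : LocalRing L v) w)) :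
    IsCompact {t : ↥(cmBorelTriple L 3 v).M | (((((⟨b, hbM⟩ : ↥(cmBorelTriple L 3 v).M))⁻¹ * t : ↥(cmBorelTriple L 3 v).M) : ↥(unitaryGroupOfForm (conjLocal L (IsCMField.complexConj L) v) (cmLocalForm L 3 v))) ∈ cmLocalIntegralLevel L 3 (Matrix.of fun i j : Fin 3 => if i.val + j.val + 1 = 3 then (1 : L) else 0) v) ∨ (((((⟨b, hbM⟩ : ↥(cmBorelTriple L 3 v).M)) * t : ↥(cmBorelTriple L 3 v).M) : ↥(unitaryGroupOfForm (conjLocal L (IsCMField.complexConj L) v) (cmLocalForm L 3 v))) ∈ cmLocalIntegralLevel L 3 (Matrix.of fun i j : Fin 3 => if i.val + j.val + 1 = 3 then (1 : L) else 0) v)} ∧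
    (∀ t ∈ {t : ↥(cmBorelTriple L 3 v).M | (((((⟨b, hbM⟩ : ↥(cmBorelTriple L 3 v).M))⁻¹ * t : ↥(cmBorelTriple L 3 v).M) : ↥(unitaryGroupOfForm (conjLocal L (IsCMField.complexConj L) v) (cmLocalForm L 3 v))) ∈ cmLocalIntegralLevel L 3 (Matrix.of fun i j : Fin 3 => if i.val + j.val + 1 = 3 then (1 : L) else 0) v) ∨ (((((⟨b, hbM⟩ : ↥(cmBorelTriple L 3 v).M)) * t : ↥(cmBorelTriple L 3 v).M) : ↥(unitaryGroupOfForm (conjLocal L (IsCMField.complexConj L) v) (cmLocalForm L 3 v))) ∈ cmLocalIntegralLevel L 3 (Matrix.of fun i j : Fin 3 => if i.val + j.val + 1 = 3 then (1 : L) else 0) v)}, IsRegularElt ((Subtype.val ((cmDatumLocalCongr L v T ha h) (t : ↥(unitaryGroupOfForm (conjLocal L (IsCMField.complexConj L) v) (cmLocalForm L 3 v))))) : GL (Fin 3) (LocalRing L v))) ∧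
    (∀ t ∈ {t : ↥(cmBorelTriple L 3 v).M | (((((⟨b, hbM⟩ : ↥(cmBorelTriple L 3 v).M))⁻¹ * t : ↥(cmBorelTriple L 3 v).M) : ↥(unitaryGroupOfForm (conjLocal L (IsCMField.complexConj L) v) (cmLocalForm L 3 v))) ∈ cmLocalIntegralLevel L 3 (Matrix.of fun i j : Fin 3 => if i.val + j.val + 1 = 3 then (1 : L) else 0) v) ∨ (((((⟨b, hbM⟩ : ↥(cmBorelTriple L 3 v).M)) * t : ↥(cmBorelTriple L 3 v).M) : ↥(unitaryGroupOfForm (conjLocal L (IsCMField.complexConj L) v) (cmLocalForm L 3 v))) ∈ cmLocalIntegralLevel L 3 (Matrix.of fun i j : Fin 3 => if i.val + j.val + 1 = 3 then (1 : L) else 0) v)}, ∀ d' : Fin 3 → (LocalRing L v)ˣ, glDiagonal 3 (LocalRing L v) d' = ((t : ↥(unitaryGroupOfForm (conjLocal L (IsCMField.complexConj L) v) (cmLocalForm L 3 v))) : GL (Fin 3) (LocalRing L v)) →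
      IsUnit ((((d' 0)⁻¹ * d' 1 : (LocalRing L v)ˣ) : LocalRing L v) - 1) ∧ IsUnit ((((d' 0)⁻¹ * d' 2 : (LocalRing L v)ˣ) : LocalRing L v) - 1)) ∧
    (∀ t : ↥(cmBorelTriple L 3 v).M, t ∉ {t : ↥(cmBorelTriple L 3 v).M | (((((⟨b, hbM⟩ : ↥(cmBorelTriple L 3 v).M))⁻¹ * t : ↥(cmBorelTriple L 3 v).M) : ↥(unitaryGroupOfForm (conjLocal L (IsCMField.complexConj L) v) (cmLocalForm L 3 v))) ∈ cmLocalIntegralLevel L 3 (Matrix.of fun i j : Fin 3 => if i.val + j.val + 1 = 3 then (1 : L) else 0) v) ∨ (((((⟨b, hbM⟩ : ↥(cmBorelTriple L 3 v).M)) * t : ↥(cmBorelTriple L 3 v).M) : ↥(unitaryGroupOfForm (conjLocal L (IsCMField.complexConj L) v) (cmLocalForm L 3 v))) ∈ cmLocalIntegralLevel L 3 (Matrix.of fun i j : Fin 3 => if i.val + j.val + 1 = 3 then (1 : L) else 0) v)} → ∀ x : ↥(unitaryGroupOfForm (conjLocal L (IsCMField.complexConj L) v) (cmLocalForm L 3 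v)),
      x * (t : ↥(unitaryGroupOfForm (conjLocal L (IsCMField.complexConj L) v) (cmLocalForm L 3 v))) * x⁻¹ ∉ tsupport ((DoubleCoset.doubleCoset b (K : Set ↥(unitaryGroupOfForm (conjLocal L (IsCMField.complexConj L) v) (cmLocalForm L 3 v))) (K : Set ↥(unitaryGroupOfForm (conjLocal L (IsCMField.complexConj L) v) (cmLocalForm L 3 v)))).indicator fun _ => (1 : ℂ))) ∧
    (∀ F : ((cmDatum L 3 H).Local v) → ℂ, tsupport F ⊆ (cmDatumLocalCongr L v T ha h) '' DoubleCoset.doubleCoset b (K : Set ↥(unitaryGroupOfForm (conjLocal L (IsCMField.complexConj L) v) (cmLocalForm L 3 v))) (K : Set ↥(unitaryGroupOfForm (conjLocal L (IsCMField.complexConj L) v) (cmLocalForm L 3 v))) →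
      ∀ t : ↥(cmBorelTriple L 3 v).M, t ∉ {t : ↥(cmBorelTriple L 3 v).M | (((((⟨b, hbM⟩ : ↥(cmBorelTriple L 3 v).M))⁻¹ * t : ↥(cmBorelTriple L 3 v).M) : ↥(unitaryGroupOfForm (conjLocal L (IsCMField.complexConj L) v) (cmLocalForm L 3 v))) ∈ cmLocalIntegralLevel L 3 (Matrix.of fun i j : Fin 3 => if i.val + j.val + 1 = 3 then (1 : L) else 0) v) ∨ (((((⟨b, hbM⟩ : ↥(cmBorelTriple L 3 v).M)) * t : ↥(cmBorelTriple L 3 v).M) : ↥(unitaryGroupOfForm (conjLocal L (IsCMField.complexConj L) v) (cmLocalForm L 3 v))) ∈ cmLocalIntegralLevel L 3 (Matrix.of fun i j : Fin 3 => if i.val + j.val + 1 = 3 then (1 : L) else 0) v)} → ∀ x : ((cmDatum L 3 H).Local v), x * (cmDatumLocalCongr L v T ha h) (t : ↥(unitaryGroupOfForm (conjLocal L (IsCMField.complexConj L) v) (cmLocalForm L 3 v))) * x⁻¹ ∉ tsupport F) :=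
  ⟨isCompact_shellTorusSet L v hbM,
    fun _ ht => isRegularElt_frame_of_mem_shellTorusSet L H w hw T ha h hbM hd h01 h12 ht,
    fun _ ht d' hd' => isUnit_torusRatio_sub_one_of_mem_shellTorusSet L w hw hbM hd h01 h12 ht d' hd',
    fun t ht x => conj_notMem_tsupport_indicator_shell_of_notMem L w hw K hKc hr hKr hbM hd h01 h12 t ht x,
    fun _ hF t ht x => conj_frame_notMem_tsupport_of_notMem L H w hw T ha h K hr hKr hbM hd h01 h12 hF t ht x⟩

end Summit.HodgeConjecture.HodgeConjecture.Cruxes.H413.F0P3cStCharTSShellOrbitalG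

end
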